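import Summits.HodgeConjecture.HodgeConjecture.Theses.RigidUnwinding

/-!
# Birth skeleton — crux `UnwindingReduction` (stmt-HodgeConjecture-14767), route `RigidUnwinding`

BC3 skeleton (registrar seat `planner-skel-stmt-HodgeConjecture-14767-0`, 2026-08-17) for the rank-3 crux
`Summit.HodgeConjecture.HodgeConjecture.Theses.RigidUnwinding.UnwindingReduction :=
KummerEndgame → RigidComparison` ("RIGID-HC ⟸ KUMMER-HC": Katz's existence algorithm for irreducible
rigid local systems — Katz1996 Thm 5.2.1 = Haraoka2020 Thm 7.24, DettweilerReiter2000 Thm 4.9 on tuples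
(tree: `DettweilerReiter2000_thm_4_9_holds`) — run BACKWARDS on the family, each middle convolution
`MC_χ` read as a bi-proper algebraic correspondence on interior cohomology, Katz inversion
`MC_χ MC_χ̄ ≅ id(−1)` realised by the degenerate-fibre cylinder cycle).

## The cut (three named stubs, composed by `UnwindingReduction_of`)

Katz's algorithm is an INDUCTION ON THE RANK `r = rk L = finrank (range (e t))` of the rigid
irreducible local system `L = im e`: an irreducible rigid `L` of rank `r ≥ 2` is `MC_χ` of a rank-one
twist of an irreducible rigid system of STRICTLY SMALLER rank, and rank one is the Kummer bottom. The
skeleton is exactly that induction, on the route's real carriers (`complexBetti`, `fiberOver`,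
`IsContinuationAlong`, `algebraicClasses`, `cupProduct`, `IsRationalClass`, `IsOfHodgeType`):

* `RigidComparisonAtRank r` (a DEFINITION, not a stub): the target `RigidComparison` VERBATIM with the
  single extra hypothesis `Module.finrank ℂ (LinearMap.range (e t)) = r` in front of its conclusion
  `∃ Ψ, Alg … Ψ ∧ Ψ ∘ₗ e t = Φ t ∘ₗ e t`. `RigidComparison ↔ ∀ r, RigidComparisonAtRank r` is proved
  below (`rigidComparison_iff_forall_atRank`, pure logic: take `r := finrank (range (e t))`).
* `stub_rankLocallyConstant` (S1, size S/M — the monodromy dictionary): for a smooth projective family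
  `f : 𝒴 → U`, `U ↪ P¹` open, and a FLAT family of idempotents `e_t` on `Hᵏ(Y_t; ℂ)` (flat = commutes
  with continuation along paths in the étalé space `FiberClass f k`), the rank of `e_t` is independent
  of `t`. Content: Ehresmann + proper base change make `FiberClass f k → U(ℂ)` a covering space whose
  path-lifts are the LINEAR transports `T_γ : Hᵏ(Y_s) ≃ₗ Hᵏ(Y_t)`; flatness reads `e_t ∘ T_γ = T_γ ∘ e_s`;
  and `U(ℂ) = P¹(ℂ) ∖ (finite set)` is path connected. (Tree: `isCoveringMap_projOver`,
  `isCohomologicallyLocallyTrivialOn_univ_of_isSmoothProjectiveFamily`, `ComplexPointsEhresmann`.)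
* `stub_finiteMonodromyOfRankLeOne` (S2, size M/L — the `r = 1` corner named by every retriage note
  on the item: "rank-one summands of a ℤ-PVHS have finite monodromy", Deligne + Kronecker): in the same
  frame, if `rk e_t ≤ 1` for all `t` then every `α ∈ im e_s` has only FINITELY many flat continuations
  along loops at `s` — literally the extra hypothesis of `KummerEndgame`. Content: `Rᵏf_*ℚ` is
  semisimple (DeligneHodgeII1971 4.2.6), so the rank-one `ℂ`-sub-local-system `L = im e` is a direct
  factor and underlies a polarizable `ℂ`-VHS (Deligne1987 Prop 1.13), hence is UNITARY; its character
  values `χ(γ)` are eigenvalues of the integral monodromy matrices `T_γ|H^k(Y_s;ℤ)`, i.e. algebraic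
  integers all of whose conjugates (characters of the conjugate lines `σL`, unitary by the same
  argument) have modulus one — roots of unity of degree `≤ b_k` (Kronecker), so `χ(π₁)` is finite. At
  rank `0` the orbit is `{0}` (unique path lifting).
* `stub_middleConvolutionDescent` (S3, THE BET, size XL — Katz's algorithm as algebraic
  correspondences, one step): for `r ≥ 2`, `RigidComparisonAtRank r'` for all `r' < r` together with
  `KummerEndgame` imply `RigidComparisonAtRank r`. Content = the route's two foreseen seams in one
  statement: (i) KATZ'S STEP — an irreducible rigid `L` of rank `r ≥ 2` on `U = P¹ ∖ S` has a rank-one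
  twist `L ⊗ Λ` and a nontrivial `χ` with `rk MC_χ(L ⊗ Λ) < r`, again irreducible rigid (Katz1996 5.2.1;
  Haraoka2020 Thm 7.14–7.15, 7.22–7.24; tree, tuple level: `RigidTuplesKatzAlgorithm.lean`,
  `middleConvolution_inv_equiv`); (ii) CONVOLUTION FUNCTORIALITY — `MC_χ(L ⊗ Λ)_t` is the `χ`-part of
  the interior cohomology of the open cyclic cover of the total space, cut out of `H^(k+1)` of a smooth
  projective COMPACTIFIED cover family over the same `U` by a flat algebraic idempotent `e''` (bi-proper
  cover graph ∘ character projector), and the flat rational Hodge-`(c,c)` comparison `Φ` induces one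
  between the two convolved systems (DettweilerSabbah2013 Thm 1 for the Hodge data; REVIEW.md N1–N2 on
  the item: relative cut-outs and the connected-fibre avatar `(D × C_ψ)/μ_N` of the twist);
  (iii) INVERSION CYCLES — Katz's inversion `MC_χ̄ MC_χ ≅ id(−1)` is induced on interior cohomology by
  the degenerate-fibre cylinder cycle `Y_t × (N lines)`, so the algebraic `Ψ''` given by the induction
  hypothesis at rank `r' < r` winds back to an algebraic `Ψ` for `L` (the why-might-fail of the item:
  boundary classes in the same isotypic part may force a B-type projector). `KummerEndgame` is offered
  to the step as well (the rank-one twists `Λ` are Kummer sheaves: finite monodromy).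

`UnwindingReduction_of : S1 → S2 → S3 → UnwindingReduction` is PROVED below (no `sorry`): strong
induction on `r`; for `r ≤ 1`, S1 spreads the rank bound from the point `t` to every `s`, S2 turns it
into the finite-monodromy hypothesis and `KummerEndgame` (the crux's own antecedent) concludes; for
`r ≥ 2`, S3; finally `RigidComparison` from all the `RigidComparisonAtRank r`.

## Honesty box

* WHERE THE DIFFICULTY SITS. S3 carries the XL content of the crux (everything at rank `≥ 2`, which the
  retriage notes of 2026-08-15 identify as "exactly the content"); S1–S2 are the `r ≤ 1` corner made
  into two genuine lemmas (neither is bookkeeping: S1 needs Ehresmann/unique path lifting on the étalé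
  carriers, S2 needs Deligne semisimplicity + Deligne 1987 + Kronecker). The finer seams of S3 foreseen
  by the route (ConvolutionFunctoriality → InversionCycles → bookkeeping) are NOT typable today: they
  need `MC_χ` on families and interior cohomology `H_!(Y) = Im(H_c → H)` with its bi-proper
  correspondences as Lean notions (the route's DEFINITION REQUESTS (1)–(2), not yet filed/landed). When
  those land, S3 splits along them with `RigidComparisonAtRank` unchanged.
* NO STUB IS THE CRUX OR THE SUMMIT IN COSTUME. S1 and S2 are theorems in print (true without any
  Hodge-conjecture input; S2 does not even use that `e` is algebraic); S3 is implied by HC (as is every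
  `RigidComparisonAtRank r`) and is strictly weaker than the crux as a statement shape (it is owed the
  induction hypothesis below `r` and says nothing at ranks `0, 1`). BC3 probes
  `stub → UnwindingReduction` and `stub → HodgeConjecture` by `first | exact? | simpa | aesop` FAIL for
  all three (registrar folder `bc/UnwindingReduction_probes.lean`, quoted in `Lines/birth.md`).
* TRUTH OF S1/S2 AS TYPED (degenerate corners checked): `U(ℂ) = ∅` makes both vacuous; rank `0` makes
  the S2 orbit `{0}`; S1's conclusion only compares points of the path-connected `U(ℂ)`; both keep the
  hypotheses `IsOpenImmersion j.left` (so `U(ℂ) ⊂ P¹(ℂ)` is cofinite, connected, quasi-projective —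
  needed for Deligne's semisimplicity) and `IsSmoothProjectiveFamily f d` (covering-space structure of
  the étalé space; polarized `ℤ`-VHS on `Hᵏ`).
* Disproof used: none — `Cruxes/UnwindingReduction/` had no `Disproof.lean` (no `_false_without_`
  theorem to honour) at registration; `ledger negatives --problem HodgeConjecture` = 3 entries
  (MilnorKExponential symbol lift, DerivedTorelliFermat K3 exhaustion, ELineTransport connectivity),
  none of the shape of S1–S3. Evidence read: refuter crux-attack 2026-08-15 (survives; shape lemmas
  `of_target`, `of_not_kummer`), route review 2026-08-16 (REVIEW.md N1–N3, N6).
-/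

set_option linter.dupNamespace false
set_option linter.unusedVariables false

-- the route file's own `open` lines (so the verbatim copy of the target elaborates identically)
open scoped BigOperators Topology Manifold Classical MeasureTheory ProbabilityTheory Matrix InnerProductSpace ComplexConjugate ContinuousMap
open Filter Set Function TopologicalSpace MeasureTheory
open CategoryTheory MonoidalCategory CartesianMonoidalCategory
open Literature.AlgebraicGeometry.Motives Literature.AlgebraicGeometry.HodgeTheory
open Literature.AlgebraicTopology.SingularHomology
open Summit.HodgeConjecture.HodgeConjecture.Theses.RigidUnwinding

namespace Summit.HodgeConjecture.HodgeConjecture.Cruxes.UnwindingReduction.Birth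

/-! ## §0 The rank stratification of the target (a definition, not a stub) -/

/-- `RigidComparisonAtRank r`: the route's target `RigidComparison` VERBATIM (same binders, same
`let Alg`, `let Flat`, same thirteen hypotheses), with the ONE extra hypothesis
`Module.finrank ℂ (LinearMap.range (e t)) = r` inserted in front of the conclusion at the point `t`.
Katz's algorithm is an induction on this `r`. -/
def RigidComparisonAtRank (r : ℕ) : Prop :=
  open CategoryTheory MonoidalCategory CartesianMonoidalCategory Literature.AlgebraicGeometry.Motives Literature.AlgebraicGeometry.HodgeTheory Literature.AlgebraicTopology.SingularHomology in ∀ (U 𝒴 : SchemeOver ℂ) (j : U ⟶ projectiveSpace 1 ℂ) (f : 𝒴 ⟶ U) (d k c : ℕ) (e : ∀ t : ComplexPoints U, complexBetti (fiberOver f t) k →ₗ[ℂ] complexBetti (fiberOver f t) k) (e' : ∀ t : ComplexPoints U, complexBetti (fiberOver f t) (k + 2 * c) →ₗ[ℂ] complexBetti (fiberOver f t) (k + 2 * c)) (Φ : ∀ t : ComplexPoints U, complexBetti (fiberOver f t) k →ₗ[ℂ] complexBetti (fiberOver f t) (k + 2 * c)), let Alg := fun (a q b : ℕ) (t : ComplexPoints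 U) (T : complexBetti (fiberOver f t) a →ₗ[ℂ] complexBetti (fiberOver f t) b) => ∃ ζ ∈ algebraicClasses (fiberOver f t ⊗ fiberOver f t) q, ∃ ω : complexBetti (fiberOver f t) (2 * d), ω ≠ 0 ∧ ∀ (b' : ℕ) (hb : b + b' = 2 * d) (hq : (a + 2 * q) + b' = 4 * d) (α : complexBetti (fiberOver f t) a) (β : complexBetti (fiberOver f t) b'), cupProduct hq (cupProduct (show a + 2 * q = a + 2 * q from rfl) (complexBetti.map (fst (fiberOver f t) (fiberOver f t)) a α) ζ) (complexBetti.map (snd (fiberOver f t) (fiberOver f t)) b' β) = cupProduct (show 2 * d + 2 * d = 4 * d by omega) (complexBetti.map (fst (fiberOver f t) (fiberOver f t)) (2 * d) ω) (complexBetti.map (snd (fiberOver f t) (fiberOver f t)) (2 * d) (cupProduct hb (T α) β)); let Flat := fun (a b : ℕ) (T : ∀ t : ComplexPoints U, complexBetti (fiberOver f t) a →ₗ[ℂ] complexBetti (fiberOver f t) b) => ∀ (s t : ComplexPoints U) (γ : Path s t) (α : complexBetti (fiberOver f s) a) (β : complexBetti (fiberOver f t) a), IsContinuationAlong γ α β →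 IsContinuationAlong γ (T s α) (T t β); AlgebraicGeometry.IsOpenImmersion j.left → Nonempty (ComplexPoints U) → IsSmoothProjectiveFamily f d → (∀ t, e t ∘ₗ e t = e t ∧ Alg k d k t (e t)) → Flat k k e → (∀ t, e' t ∘ₗ e' t = e' t ∧ Alg (k + 2 * c) d (k + 2 * c) t (e' t)) → Flat (k + 2 * c) (k + 2 * c) e' → Flat k (k + 2 * c) Φ → (∀ t x, IsRationalClass x → IsRationalClass (Φ t x)) → (∀ t (p q : ℕ), p + q = k → ∀ x, IsOfHodgeType d (fiberOver f t) k p q x → IsOfHodgeType d (fiberOver f t) (k + 2 * c) (p + c) (q + c) (Φ t x)) → (∀ t, Submodule.map (Φ t) (LinearMap.range (e t)) = LinearMap.range (e' t)) → (∀ M : (∀ t : ComplexPoints U, Submodule ℂ (complexBetti (fiberOver f t) k)), (∀ t, M t ≤ LinearMap.range (e t)) → (∀ (s t : ComplexPoints U) (γ : Path s t) (α : complexBetti (fiberOver f s) k) (β : complexBetti (fiberOver f t) k), α ∈ M s → IsContinuationAlong γ α β → β ∈ M t) → (∀ t, M t = ⊥) ∨ (∀ t, M t = LinearMap.range (e t)))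 → (∃ dloc : {p : ComplexPoints (projectiveSpace 1 ℂ) // p ∉ Set.range (AlgPoints.map j)} → ℕ, (∀ p : {p : ComplexPoints (projectiveSpace 1 ℂ) // p ∉ Set.range (AlgPoints.map j)}, ∃ O₀ ∈ nhds p.1, ∀ O ∈ nhds p.1, O ⊆ O₀ → IsOpen O → IsConnected O → Module.finrank ℂ (Submodule.span ℂ {ψ : ∀ t : ComplexPoints U, complexBetti (fiberOver f t) k →ₗ[ℂ] complexBetti (fiberOver f t) k | (∀ t, ψ t ∘ₗ e t = ψ t ∧ e t ∘ₗ ψ t = ψ t) ∧ (∀ t, AlgPoints.map j t ∉ O → ψ t = 0) ∧ ∀ (s t : ComplexPoints U) (γ : Path s t), (∀ x, AlgPoints.map j (γ x) ∈ O) → ∀ (α : complexBetti (fiberOver f s) k) (β : complexBetti (fiberOver f t) k), IsContinuationAlong γ α β → IsContinuationAlong γ (ψ s α) (ψ t β)}) = dloc p) ∧ ∀ t, (∑ᶠ p, (dloc p : ℤ)) = ((Nat.card {p : ComplexPoints (projectiveSpace 1 ℂ) // p ∉ Set.range (AlgPoints.map j)} : ℤ) - 2) * (Module.finrank ℂ (LinearMap.range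 (e t)) : ℤ) ^ 2 + 2) → ∀ t, Module.finrank ℂ (LinearMap.range (e t)) = r → ∃ Ψ : complexBetti (fiberOver f t) k →ₗ[ℂ] complexBetti (fiberOver f t) (k + 2 * c), Alg k (d + c) (k + 2 * c) t Ψ ∧ Ψ ∘ₗ e t = Φ t ∘ₗ e t


/-! ## §1 Statements of the stubs -/

/-- Statement of STUB S1 — **FLAT IDEMPOTENTS HAVE LOCALLY CONSTANT RANK** (monodromy dictionary). For a
smooth projective family `f : 𝒴 → U` over an open `U ↪ P¹_ℂ` and a family of idempotents `e_t` on
`Hᵏ(Y_t(ℂ); ℂ)` commuting with flat continuation along every path (`Flat k k e` of the route frame,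
written out), `rk e_s = rk e_t` for all complex points `s, t` of `U`. Why plausibly true: the étalé
space `FiberClass f k → U(ℂ)` is a covering space with linear transports (Ehresmann + proper base
change), flatness says `e_t ∘ T_γ = T_γ ∘ e_s`, and `U(ℂ)` (cofinite in `P¹(ℂ)`) is path connected.
Size S/M. [Voisin2003HodgeI §9.2.1; DeligneHodgeII1971 4.1.1] -/
def RankLocallyConstant : Prop :=
  ∀ (U 𝒴 : SchemeOver ℂ) (j : U ⟶ projectiveSpace 1 ℂ) (f : 𝒴 ⟶ U) (d k : ℕ)
    (e : ∀ t : ComplexPoints U, complexBetti (fiberOver f t) k →ₗ[ℂ] complexBetti (fiberOver f t) k),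
    AlgebraicGeometry.IsOpenImmersion j.left → IsSmoothProjectiveFamily f d →
    (∀ t, e t ∘ₗ e t = e t) →
    (∀ (s t : ComplexPoints U) (γ : Path s t) (α : complexBetti (fiberOver f s) k)
        (β : complexBetti (fiberOver f t) k),
        IsContinuationAlong γ α β → IsContinuationAlong γ (e s α) (e t β)) →
    ∀ s t : ComplexPoints U,
      Module.finrank ℂ (LinearMap.range (e s)) = Module.finrank ℂ (LinearMap.range (e t))

/-- Statement of STUB S2 — **RANK ≤ 1 FLAT SUB-SYSTEMS OF `Rᵏ f_* ℂ` HAVE FINITE MONODROMY** (the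
`r = 1` corner of Katz's algorithm = the bottom handed to `KummerEndgame`). Same frame as S1; if
`rk e_t ≤ 1` for every `t`, then for every `s` and every `α ∈ im e_s` the set of flat continuations of
`α` along loops at `s` is finite — literally the finite-monodromy hypothesis of `KummerEndgame`. Why
plausibly true: `Rᵏ f_* ℚ` is semisimple (Deligne, Hodge II 4.2.6), so the line `L = im e` is a direct
factor of `Rᵏ f_* ℂ` and underlies a polarizable `ℂ`-VHS (Deligne 1987, 1.13), hence is unitary; its
character values are eigenvalues of the INTEGRAL monodromy, algebraic integers all of whose conjugates
have modulus one, i.e. roots of unity of bounded degree (Kronecker) — finitely many. Rank `0`: the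
orbit of `α = 0` is `{0}`. Size M/L (needs the covering-space structure of `FiberClass`, integrality of
transport `IsContinuationAlong.isIntegralClass_of_isSmoothProjectiveFamily`, and the VHS package).
[DeligneHodgeII1971 4.2.6; Deligne1987 Prop 1.13; Kronecker 1857] -/
def FiniteMonodromyOfRankLeOne : Prop :=
  ∀ (U 𝒴 : SchemeOver ℂ) (j : U ⟶ projectiveSpace 1 ℂ) (f : 𝒴 ⟶ U) (d k : ℕ)
    (e : ∀ t : ComplexPoints U, complexBetti (fiberOver f t) k →ₗ[ℂ] complexBetti (fiberOver f t) k),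
    AlgebraicGeometry.IsOpenImmersion j.left → IsSmoothProjectiveFamily f d →
    (∀ t, e t ∘ₗ e t = e t) →
    (∀ (s t : ComplexPoints U) (γ : Path s t) (α : complexBetti (fiberOver f s) k)
        (β : complexBetti (fiberOver f t) k),
        IsContinuationAlong γ α β → IsContinuationAlong γ (e s α) (e t β)) →
    (∀ t, Module.finrank ℂ (LinearMap.range (e t)) ≤ 1) →
    ∀ (s : ComplexPoints U) (α : complexBetti (fiberOver f s) k), α ∈ LinearMap.range (e s) →
      Set.Finite {β : complexBetti (fiberOver f s) k | ∃ γ : Path s s, IsContinuationAlong γ α β}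

/-- Statement of STUB S3 — **MIDDLE-CONVOLUTION DESCENT** (one step of Katz's algorithm run backwards,
as algebraic correspondences; THE BET of the route). For `r ≥ 2`: the rigid-comparison statement at
all ranks `r' < r`, together with the Kummer endgame, implies it at rank `r`. Informal content: Katz's
step (rank-one twist + `MC_χ` strictly lowers the rank of an irreducible rigid system, preserving
irreducibility and rigidity: Katz1996 5.2.1, Haraoka2020 Thm 7.14–7.15/7.24), convolution
functoriality (the convolved systems are cut out of `H^(k+1)` of a smooth projective compactified
cyclic-cover family over the same `U` by flat ALGEBRAIC idempotents, and `Φ` convolves to a flat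
rational Hodge-`(c,c)` comparison between them: DettweilerSabbah2013 Thm 1), and inversion cycles
(Katz's `MC_χ̄ MC_χ ≅ id(−1)` induced on interior cohomology by the degenerate-fibre cylinder cycle,
winding the algebraic `Ψ''` of the induction hypothesis back to an algebraic `Ψ`). Why it might fail:
the item's own — boundary classes live in the same isotypic part (`h¹_c − h¹_! ≠ 0`), so the cylinder
class may fail to be interior and need a Standard-Conjecture-B-type projector. Size XL.
[Katz1996; Haraoka2020; Dettweiler2008MC; DettweilerSabbah2013; DettweilerReiter2010; Andre1996Motifs] -/
def MiddleConvolutionDescent : Prop :=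
  ∀ r : ℕ, 2 ≤ r → (∀ r', r' < r → RigidComparisonAtRank r') → KummerEndgame →
    RigidComparisonAtRank r

/-! ## §2 The stubs (the ONLY `sorry`s of this file) -/

/-- STUB S1 (registered): flat idempotents have locally constant rank, `RankLocallyConstant`. -/
theorem stub_rankLocallyConstant : RankLocallyConstant := by
  sorry

/-- STUB S2 (registered): rank `≤ 1` flat sub-systems have finite monodromy,
`FiniteMonodromyOfRankLeOne`. -/
theorem stub_finiteMonodromyOfRankLeOne : FiniteMonodromyOfRankLeOne := by
  sorry

/-- STUB S3 (registered): the middle-convolution descent step, `MiddleConvolutionDescent`. -/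
theorem stub_middleConvolutionDescent : MiddleConvolutionDescent := by
  sorry

/-! ### Name-keyed aliases (the skeleton audit admits a hypothesis of `UnwindingReduction_of` iff the
head constant of its type has the short name of a declared stub) -/
namespace Registered

/-- Alias of `RankLocallyConstant` keyed by the registered stub name. -/
abbrev stub_rankLocallyConstant : Prop := RankLocallyConstant
/-- Alias of `FiniteMonodromyOfRankLeOne` keyed by the registered stub name. -/
abbrev stub_finiteMonodromyOfRankLeOne : Prop := FiniteMonodromyOfRankLeOne
/-- Alias of `MiddleConvolutionDescent` keyed by the registered stub name. -/
abbrev stub_middleConvolutionDescent : Prop := MiddleConvolutionDescent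

end Registered

/-! ## §3 Composition (no `sorry` below this line) -/

/-- The rank stratification is faithful: `RigidComparison ↔ ∀ r, RigidComparisonAtRank r`
(pure logic — at the point `t` take `r := finrank (range (e t))`). -/
theorem rigidComparison_iff_forall_atRank : RigidComparison ↔ ∀ r, RigidComparisonAtRank r := by
  constructor
  · intro h r U 𝒴 j f d k c e e' Φ Alg Flat hj hne hf he hfe he' hfe' hΦ hrat hhodge hmap hirr hrig t _
    exact h U 𝒴 j f d k c e e' Φ hj hne hf he hfe he' hfe' hΦ hrat hhodge hmap hirr hrig t
  · intro h U 𝒴 j f d k c e e' Φ Alg Flat hj hne hf he hfe he' hfe' hΦ hrat hhodge hmap hirr hrig t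
    exact h _ U 𝒴 j f d k c e e' Φ hj hne hf he hfe he' hfe' hΦ hrat hhodge hmap hirr hrig t rfl

/-- Base of the induction (`r ≤ 1`): S1 spreads the rank bound from `t` to every point, S2 turns it
into finite monodromy of `L = im e`, and the Kummer endgame concludes. -/
theorem rigidComparisonAtRank_of_le_one (h₁ : RankLocallyConstant)
    (h₂ : FiniteMonodromyOfRankLeOne) (hK : KummerEndgame) :
    ∀ r, r ≤ 1 → RigidComparisonAtRank r := by
  intro r hr U 𝒴 j f d k c e e' Φ Alg Flat hj hne hf he hfe he' hfe' hΦ hrat hhodge hmap hirr hrig t ht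
  -- S1: the rank of `e` is the same at every point, hence `≤ 1` everywhere
  have hrk : ∀ s, Module.finrank ℂ (LinearMap.range (e s)) ≤ 1 := fun s => by
    rw [h₁ U 𝒴 j f d k e hj hf (fun u => (he u).1) hfe s t, ht]
    exact hr
  -- S2: finite monodromy on `L = im e`
  have hfin : ∀ (s : ComplexPoints U) (α : complexBetti (fiberOver f s) k),
      α ∈ LinearMap.range (e s) →
        Set.Finite {β : complexBetti (fiberOver f s) k | ∃ γ : Path s s, IsContinuationAlong γ α β} :=
    h₂ U 𝒴 j f d k e hj hf (fun u => (he u).1) hfe hrk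
  -- the Kummer endgame (the crux's own antecedent) in the same frame
  exact hK U 𝒴 j f d k c e e' Φ hj hne hf he hfe he' hfe' hΦ hrat hhodge hmap hirr hfin t

/-- **The three stubs imply the crux, BY NAME** — Katz's algorithm run backwards: strong induction on
the rank `r` of `L = im e` (base `r ≤ 1`: S1 + S2 + the Kummer endgame; step `r ≥ 2`: S3), then
`RigidComparison` from all the `RigidComparisonAtRank r`. -/
theorem UnwindingReduction_of (h₁ : Registered.stub_rankLocallyConstant)
    (h₂ : Registered.stub_finiteMonodromyOfRankLeOne)
    (h₃ : Registered.stub_middleConvolutionDescent) : UnwindingReduction := by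
  intro hK
  -- strong induction on the rank, written as a bounded induction on `n ≥ r`
  have hall : ∀ n r, r ≤ n → RigidComparisonAtRank r := by
    intro n
    induction n with
    | zero =>
      intro r hr
      exact rigidComparisonAtRank_of_le_one h₁ h₂ hK r (by omega)
    | succ n ih =>
      intro r hr
      rcases Nat.lt_or_ge r 2 with hr2 | hr2
      · exact rigidComparisonAtRank_of_le_one h₁ h₂ hK r (by omega)
      · exact h₃ r hr2 (fun r' hr' => ih r' (by omega)) hK
  exact rigidComparison_iff_forall_atRank.2 fun r => hall r r le_rfl

/-- Wiring check: the registered stubs feed the composition as stated (definitional unfolding only). -/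
example : UnwindingReduction :=
  UnwindingReduction_of stub_rankLocallyConstant stub_finiteMonodromyOfRankLeOne
    stub_middleConvolutionDescent

/-! ## §4 Plumbing sanity (proved, no sorry): the step stub is owed nothing it could abuse — at `r ≥ 2`
its induction hypothesis is available exactly for `r' ∈ {0, …, r-1}`, and the composition consumes
`KummerEndgame` only through S2's conclusion and S3. (Not evidence for any stub.) -/
example (P : ℕ → Prop) (h01 : ∀ r, r ≤ 1 → P r)
    (hstep : ∀ r, 2 ≤ r → (∀ r', r' < r → P r') → P r) : ∀ r, P r := by
  have hall : ∀ n r, r ≤ n → P r := by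
    intro n
    induction n with
    | zero => intro r hr; exact h01 r (by omega)
    | succ n ih =>
      intro r hr
      rcases Nat.lt_or_ge r 2 with hr2 | hr2
      · exact h01 r (by omega)
      · exact hstep r hr2 fun r' hr' => ih r' (by omega)
  exact fun r => hall r r le_rfl

end Summit.HodgeConjecture.HodgeConjecture.Cruxes.UnwindingReduction.Birth
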